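import Mathlib
import Literature.LinearAlgebra.Matrix.RankMinors

/-!
# Flattenings of border sums of powers of linear forms (helper for `ChowBorderDepth3.LocalFanInTwo`)

Support file for item `stmt-ValiantsHypothesis-5938` (`LocalFanInTwo`) of route
`ValiantsHypothesis/ChowBorderDepth3`.  The classical lower bound "border Waring rank ≥ rank of a
catalecticant (flattening)" (Landsberg 2017, §2.1 / §6.2; Iarrobino–Kanev LNM 1721 §1.1), in the
coordinates the item needs and with no new definitions:

* iterated partial derivatives along a WORD `w : List σ`, written
  `w.foldr (fun v g => pderiv v g) f` (so `[v₁,…,v_k] ↦ ∂_{v₁} ⋯ ∂_{v_k} f`): linearity,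
  compatibility with `MvPolynomial.map`, the coefficient formula
  `coeff e (∂_w f) = K · coeff (e + deg w) f` (`K = 1` on words of distinct letters off `supp e`),
  and the closed form on powers of a linear form
  `∂_w (Σ_v l_v x_v)^m = m(m-1)⋯(m-|w|+1) · (∏_{v ∈ w} l_v) · ℓ^{m-|w|}`;
* `det_mul_eq_zero_of_card_lt`: over a domain, `det (A * B) = 0` when the inner dimension is
  smaller than the outer one (via the fraction field and `Matrix.rank`);
* `card_le_card_of_border_powers`: if `Σ_{s ∈ ι} c_s ℓ_s(ε)^n = ε^γ · Q(ε)` over `ℂ[ε]` with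
  `Q(0) = a · f`, `a ≠ 0`, then every `ρ × ρ` matrix of full iterated derivatives
  `(∂_{α i ++ β j} f)_{i,j}` (`|α i| + |β j| = n`) with non-zero determinant has `|ρ| ≤ |ι|` —
  the flattening `(∂_{α i ++ β j} ·)` of the left side factors through `ℂ[ε]^ι`.

References: J. M. Landsberg, *Geometry and complexity theory*, CUP 2017, §6.2 (flattenings and
border rank); A. Iarrobino, V. Kanev, LNM 1721 (1999), §1.1 (catalecticants).
-/

noncomputable section

-- `Summit.ValiantsHypothesis.ValiantsHypothesis.…` is the tree's mandated single-conjunct layout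
-- (Sub = Summit), so the duplicated namespace component is intended.
set_option linter.dupNamespace false

namespace Summit.ValiantsHypothesis.ValiantsHypothesis.Theorems.ChowBorderDepth3LocalFanInTwo

open MvPolynomial

open scoped Polynomial

section IteratedDerivative

variable {σ : Type*} {R : Type*} [CommRing R]

/-- `∂_w 0 = 0`. [folklore] -/
theorem iterD_zero (w : List σ) :
    w.foldr (fun v g => pderiv v g) (0 : MvPolynomial σ R) = 0 := by
  induction w with
  | nil => rfl
  | cons v w ih => simp only [List.foldr_cons, ih, map_zero]

/-- Additivity of `f ↦ ∂_w f`. [folklore] -/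
theorem iterD_add (w : List σ) (f g : MvPolynomial σ R) :
    w.foldr (fun v g => pderiv v g) (f + g) =
      w.foldr (fun v g => pderiv v g) f + w.foldr (fun v g => pderiv v g) g := by
  induction w with
  | nil => rfl
  | cons v w ih => simp only [List.foldr_cons, ih, map_add]

/-- `∂_w (C a · f) = C a · ∂_w f`. [folklore] -/
theorem iterD_C_mul (w : List σ) (a : R) (f : MvPolynomial σ R) :
    w.foldr (fun v g => pderiv v g) (C a * f) = C a * w.foldr (fun v g => pderiv v g) f := by
  induction w with
  | nil => rfl
  | cons v w ih => simp only [List.foldr_cons, ih, pderiv_C_mul]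

/-- `∂_w (Σ_s f_s) = Σ_s ∂_w f_s`. [folklore] -/
theorem iterD_sum {ι : Type*} (s : Finset ι) (w : List σ) (f : ι → MvPolynomial σ R) :
    w.foldr (fun v g => pderiv v g) (∑ i ∈ s, f i) =
      ∑ i ∈ s, w.foldr (fun v g => pderiv v g) (f i) := by
  classical
  induction s using Finset.induction_on with
  | empty => simp only [Finset.sum_empty, iterD_zero]
  | insert a s ha ih => rw [Finset.sum_insert ha, Finset.sum_insert ha, iterD_add, ih]

/-- `∂_w` commutes with a change of scalars `MvPolynomial.map φ`. [folklore] -/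
theorem map_iterD {S : Type*} [CommRing S] (φ : R →+* S) (w : List σ) (f : MvPolynomial σ R) :
    MvPolynomial.map φ (w.foldr (fun v g => pderiv v g) f) =
      w.foldr (fun v g => pderiv v g) (MvPolynomial.map φ f) := by
  induction w with
  | nil => rfl
  | cons v w ih => simp only [List.foldr_cons, ← ih, pderiv_map]

/-- **Coefficient formula.** `coeff e (∂_w f) = K · coeff (e + deg w) f` for a natural number `K`
depending only on `e` and `w` (a product of exponents), where `deg w = Σ_{v ∈ w} e_v`. [folklore] -/
theorem exists_coeff_iterD (w : List σ) :
    ∀ e : σ →₀ ℕ, ∃ K : ℕ, ∀ f : MvPolynomial σ R,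
      coeff e (w.foldr (fun v g => pderiv v g) f) =
        K * coeff (e + (w.map fun v => Finsupp.single v 1).sum) f := by
  induction w with
  | nil => intro e; exact ⟨1, fun f => by simp⟩
  | cons v w ih =>
    intro e
    obtain ⟨K, hK⟩ := ih (e + Finsupp.single v 1)
    refine ⟨K * (e v + 1), fun f => ?_⟩
    simp only [List.foldr_cons, coeff_pderiv, hK, List.map_cons, List.sum_cons]
    push_cast
    rw [show e + Finsupp.single v 1 + (List.map (fun v => Finsupp.single v 1) w).sum =
      e + (Finsupp.single v 1 + (List.map (fun v => Finsupp.single v 1) w).sum) from add_assoc _ _ _]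
    ring

/-- On a word of DISTINCT letters avoiding the support of `e`, all the exponent factors are `1`:
`coeff e (∂_w f) = coeff (e + deg w) f`. [folklore] -/
theorem coeff_iterD_of_nodup (w : List σ) (hw : w.Nodup) :
    ∀ e : σ →₀ ℕ, (∀ v ∈ w, e v = 0) → ∀ f : MvPolynomial σ R,
      coeff e (w.foldr (fun v g => pderiv v g) f) =
        coeff (e + (w.map fun v => Finsupp.single v 1).sum) f := by
  classical
  induction w with
  | nil => intro e _ f; simp
  | cons v w ih =>
    intro e he f
    rw [List.nodup_cons] at hw
    have hev : e v = 0 := he v List.mem_cons_self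
    have he' : ∀ u ∈ w, (e + Finsupp.single v 1 : σ →₀ ℕ) u = 0 := by
      intro u hu
      have huv : v ≠ u := fun h => hw.1 (h ▸ hu)
      rw [Finsupp.add_apply, he u (List.mem_cons_of_mem v hu), Finsupp.single_apply, if_neg huv,
        add_zero]
    rw [List.foldr_cons, coeff_pderiv, ih hw.2 _ he', List.map_cons, List.sum_cons, hev,
      Nat.cast_zero, zero_add, mul_one, add_assoc]

/-- The derivative of a linear form `ℓ = Σ_v l_v x_v` in the direction `x_v` is the constant
`l_v`. [folklore] -/
theorem pderiv_linearForm [Fintype σ] [DecidableEq σ] (l : σ → R) (v : σ) :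
    pderiv v (∑ u, C (l u) * X u : MvPolynomial σ R) = C (l v) := by
  simp only [map_sum, pderiv_C_mul, pderiv_X, Pi.single_apply, mul_ite, mul_one, mul_zero,
    Finset.sum_ite_eq', Finset.mem_univ, if_true]

/-- **Iterated derivatives of a power of a linear form**:
`∂_w ℓ^m = m(m-1)⋯(m-|w|+1) · (∏_{v ∈ w} l_v) · ℓ^{m-|w|}` for `ℓ = Σ_v l_v x_v`. [folklore] -/
theorem iterD_linearForm_pow [Fintype σ] [DecidableEq σ] (l : σ → R) (m : ℕ) (w : List σ) :
    w.foldr (fun v g => pderiv v g) ((∑ u, C (l u) * X u : MvPolynomial σ R) ^ m) =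
      C ((m.descFactorial w.length : R) * (w.map l).prod) *
        (∑ u, C (l u) * X u : MvPolynomial σ R) ^ (m - w.length) := by
  induction w with
  | nil => simp
  | cons v w ih =>
    rw [List.foldr_cons, ih, pderiv_C_mul, pderiv_pow, pderiv_linearForm, List.length_cons,
      Nat.descFactorial_succ, List.map_cons, List.prod_cons,
      show m - (w.length + 1) = m - w.length - 1 from rfl]
    rw [← map_natCast (C : R →+* MvPolynomial σ R)]
    push_cast
    simp only [← mul_assoc, ← map_mul, mul_comm _ (C (l v))]
    congr 2
    ring

end IteratedDerivative

section Determinant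

/-- Over a domain, a product `A * B` of a `ρ × ι` and a `ι × ρ` matrix with `|ι| < |ρ|` is
singular: `det (A * B) = 0` (its rank over the fraction field is at most `|ι|`). [folklore] -/
theorem det_mul_eq_zero_of_card_lt {R : Type*} [CommRing R] [IsDomain R] {ρ ι : Type*}
    [Fintype ρ] [DecidableEq ρ] [Fintype ι] (A : Matrix ρ ι R) (B : Matrix ι ρ R)
    (h : Fintype.card ι < Fintype.card ρ) : (A * B).det = 0 := by
  let K := FractionRing R
  let φ : R →+* K := algebraMap R K
  have hinj : Function.Injective φ := IsFractionRing.injective R K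
  apply hinj
  rw [map_zero, RingHom.map_det, RingHom.mapMatrix_apply, Matrix.map_mul]
  have hr : (A.map φ * B.map φ).rank < Fintype.card ρ :=
    lt_of_le_of_lt ((Matrix.rank_mul_le_left _ _).trans (Matrix.rank_le_card_width _)) h
  simpa using
    Literature.LinearAlgebra.Matrix.det_submatrix_eq_zero_of_rank_lt_card _ id id hr

end Determinant

section Border

variable {σ ι ρ : Type*}

/-- The flattening matrix `(coeff 0 (∂_{α i ++ β j} g))_{i,j}` is `ℂ[ε]`-linear in `g`:
constants pull out. [folklore] -/
theorem flattening_C_mul {R : Type*} [CommRing R] (α β : ρ → List σ) (r : R)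
    (g : MvPolynomial σ R) :
    (Matrix.of fun i j => coeff 0 ((α i ++ β j).foldr (fun v g => pderiv v g) (C r * g))) =
      r • Matrix.of fun i j => coeff 0 ((α i ++ β j).foldr (fun v g => pderiv v g) g) := by
  ext i j
  simp only [Matrix.of_apply, Matrix.smul_apply, iterD_C_mul, coeff_C_mul, smul_eq_mul]

/-- The flattening matrix commutes with a change of scalars. [folklore] -/
theorem flattening_map {R S : Type*} [CommRing R] [CommRing S] (φ : R →+* S) (α β : ρ → List σ)
    (g : MvPolynomial σ R) :
    (Matrix.of fun i j => coeff 0 ((α i ++ β j).foldr (fun v g => pderiv v g) g)).map φ =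
      Matrix.of fun i j =>
        coeff 0 ((α i ++ β j).foldr (fun v g => pderiv v g) (MvPolynomial.map φ g)) := by
  ext i j
  simp only [Matrix.map_apply, Matrix.of_apply, ← map_iterD, coeff_map]

/-- **The flattening of a sum of `|ι|` powers of linear forms factors through `R^ι`**: with
`|α i| + |β j| = n`, `(coeff 0 (∂_{α i ++ β j} Σ_s c_s ℓ_s^n))_{i,j} = A * B` for explicit
`ρ × ι` and `ι × ρ` matrices. [cite: LandsbergGCT2017, §6.2] -/
theorem flattening_sum_pow_eq_mul {R : Type*} [CommRing R] [Fintype σ] [DecidableEq σ] [Fintype ι]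
    {n : ℕ} (c : ι → R) (l : ι → σ → R)
    (α β : ρ → List σ) (hαβ : ∀ i j, (α i).length + (β j).length = n) :
    (Matrix.of fun i j => coeff 0 ((α i ++ β j).foldr (fun v g => pderiv v g)
        (∑ s, C (c s) * (∑ u, C (l s u) * X u : MvPolynomial σ R) ^ n))) =
      (Matrix.of fun i s => c s * (n.factorial : R) * ((α i).map (l s)).prod) *
        (Matrix.of fun s j => ((β j).map (l s)).prod) := by
  ext i j
  simp only [Matrix.of_apply, Matrix.mul_apply, iterD_sum, iterD_C_mul, iterD_linearForm_pow,
    coeff_sum, coeff_C_mul, List.length_append, hαβ i j, Nat.sub_self, pow_zero, mul_one,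
    coeff_zero_one, Nat.descFactorial_self, List.map_append, List.prod_append]
  refine Finset.sum_congr rfl fun s _ => ?_
  ring

/-- **Border sums of powers have small flattenings.** Let `Σ_{s ∈ ι} c_s(ε) ℓ_s(ε)^n = ε^γ · Q(ε)`
over `ℂ[ε]`, with `Q(0) = a · f` and `a ≠ 0` (so `f` has border Waring rank `≤ |ι|`). If some
`ρ × ρ` matrix of full iterated derivatives `(∂_{α i ++ β j} f)_{i,j}`, `|α i| + |β j| = n`, has
non-zero determinant, then `|ρ| ≤ |ι|`: the same matrix for the left side is `ε^{γ|ρ|}` times a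
polynomial matrix whose determinant is `a^{|ρ|} det ≠ 0` at `ε = 0`, yet it factors through
`ℂ[ε]^ι` (Landsberg 2017 §6.2: flattening rank is lower semicontinuous and at most the rank of a
sum of powers). [cite: LandsbergGCT2017, §6.2] -/
theorem card_le_card_of_border_powers [Fintype σ] [DecidableEq σ] [Fintype ι] [Fintype ρ]
    [DecidableEq ρ] {n γ : ℕ} (c : ι → ℂ[X]) (l : ι → σ → ℂ[X])
    (Q : MvPolynomial σ ℂ[X]) (f : MvPolynomial σ ℂ) (a : ℂ) (ha : a ≠ 0)
    (hsum : ∑ s, C (c s) * (∑ u, C (l s u) * X u : MvPolynomial σ ℂ[X]) ^ n =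
      C (Polynomial.X ^ γ) * Q)
    (hQ : MvPolynomial.map Polynomial.constantCoeff Q = C a * f)
    (α β : ρ → List σ) (hαβ : ∀ i j, (α i).length + (β j).length = n)
    (hdet : (Matrix.of fun i j =>
      coeff 0 ((α i ++ β j).foldr (fun v g => pderiv v g) f)).det ≠ 0) :
    Fintype.card ρ ≤ Fintype.card ι := by
  by_contra hlt
  rw [not_le] at hlt
  -- the flattening of the left side is singular
  have hzero : (Matrix.of fun i j => coeff 0 ((α i ++ β j).foldr (fun v g => pderiv v g)
      (C (Polynomial.X ^ γ) * Q))).det = 0 := by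
    rw [← hsum, flattening_sum_pow_eq_mul c l α β hαβ]
    exact det_mul_eq_zero_of_card_lt _ _ hlt
  -- but it is `ε^{γ|ρ|}` times a determinant that is `a^{|ρ|} det ≠ 0` at `ε = 0`
  rw [flattening_C_mul, Matrix.det_smul, mul_eq_zero] at hzero
  rcases hzero with h | h
  · exact pow_ne_zero _ (pow_ne_zero _ Polynomial.X_ne_zero) h
  · have h0 := congrArg Polynomial.constantCoeff h
    rw [RingHom.map_det, RingHom.mapMatrix_apply, flattening_map, hQ, flattening_C_mul,
      Matrix.det_smul, map_zero, mul_eq_zero] at h0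
    rcases h0 with h0 | h0
    · exact pow_ne_zero _ ha h0
    · exact hdet h0

end Border

end Summit.ValiantsHypothesis.ValiantsHypothesis.Theorems.ChowBorderDepth3LocalFanInTwo

end
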